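import Summits.RiemannHypothesis.RiemannHypothesis.Theorems.SemilocalNegCertFiftyNineKinked2061PiecesA
import Summits.RiemannHypothesis.RiemannHypothesis.Theorems.SemilocalNegCertFiftyNineKinked2061PiecesB
import Summits.RiemannHypothesis.RiemannHypothesis.Theorems.HandoffLadderRungOne
import Summits.RiemannHypothesis.RiemannHypothesis.Theorems.HandoffUpperClausesC
import Summits.RiemannHypothesis.RiemannHypothesis.Theorems.SemilocalClassLaw
import Summits.RiemannHypothesis.RiemannHypothesis.Theorems.SemilocalLogAtomsD
import HarnessLib

/-!
# Semi-local threshold of the `{∞,2,…,59}` form, negative side: `a*({2,…,59}) ≤ 1055 / 512 = 2.060546875` — the wall `q = 61` from a KINKED (piecewise-cubic) witness with slope breaks at the prime-atom images (part 24/24: the composition of the piece facts and the THEOREMS)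

Cell `rh-explicit` (HOME `run/shared/lean/pub/rh-explicit/`), seat cc-s2-9 gen3 (HUMAN RULING D-0074 (D5) WEIL data engine; LADDER-RH column WEIL, rung DATA → W-P(P2);
pipeline = cc-s2-4 gen8/gen11's piecewise-witness layer `SemilocalPiecewise{Witness,Increment,IncrementSum,Cert}.lean` + their float finder, every number
re-derived by an independent second engine E2 before filing; gen0/gen2 rows: `SemilocalNegCert{ThirteenKinked1423,…,FiftyThreeKinked2044}*`, capstone `SemilocalKinkedWallOffsets`).
HONEST FRAMING: RH-FREE theorems about the tree's `weilSemilocalThreshold S` of a TRUNCATED Weil form (finitely many places); nothing here bears on the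
truth of RH; the lower clause `(log q)/2 ≤ a*(S_q)` at all primes IS RH and is untouched; the SIGN of `δ*(61)` is not claimed.

KINKED row for the wall `q = 61` (`S = {2,…,59}`): at `b = 1055 / 512 = 2.060546875 ≈ a*(S_61) + 0.0051` (DATA, two engines, cc-s2-6/cc-s2-3: `a*(S_61) = 2.0554656`)
the polynomial × indicator class is far from negative (tree row `267/128`, `SemilocalNegCertUptoFiftyNine`, `δ*(61) ≤ 0.0305`), whereas an odd piecewise cubic with slope breaks at the images
`|b − log n|` (rounded to `/1024`) of the atoms `n ∈ {3,5,7,11,13,17,19,23,29,31,37,41,43,47,53,59}` (the odd-prime atoms; all atom images resp. all primes resp. primes + 4 + 9 scanned, kit j257393) is negative by `2.827e-03·‖G‖²`.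
Instance: `S = {2, 3, 5, 7, 11, 13, 17, 19, 23, 29, 31, 37, 41, 43, 47, 53, 59}`, `N = 63` (atom table `atomsUptoFiftyNineN63` / `atomsEnclose_UptoFiftyNineN63` of THIS file: the tree's `atomsUptoFiftyNine` (`N = 64`, `SemilocalNegCertUptoFiftyNine.lean`) minus the atom `64`, whose image lies above `2b`), 17 pieces of degree ≤ 3, 298 `t`-pieces;
TWO ENGINES on the witness before the kernel: cc-s2-4's float finder `λ_min = -2.8274e-03` and the seat's exact-in-`x` decimal engine E2 `R = -2.8378e-03` (no polar credit);
the exact kernel margin is the certificate's own rational arithmetic (farm report).  ⇒ **`a*({2,…,59}) ≤ 1055 / 512`, `δ*(61) < 0.00511`** (was `0.0305`).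
No data is trusted: every bound is a `decide +kernel` fact.  Folklore throughout.
-/

set_option autoImplicit false
set_option linter.dupNamespace false  -- the mandated namespace repeats `RiemannHypothesis`
set_option Elab.async false  -- serialise the kernel facts: in parallel they exhaust the node's per-process heap (cc-s2-4 gen11, CC4-LEAN §16.10)

noncomputable section

open Complex Filter Set MeasureTheory Topology
open scoped Real

namespace Summit.RiemannHypothesis.RiemannHypothesis.Theorems.SemilocalPolyWitness

open MeasureTheory Set Finset Real
open Literature.NumberTheory.LFunctions
open Summit.RiemannHypothesis.RiemannHypothesis.Theorems.MotivicDoor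
open Summit.RiemannHypothesis.RiemannHypothesis.Theorems.MotivicDoor.SemilocalThreshold
open Summit.RiemannHypothesis.RiemannHypothesis.Theorems.MotivicDoor.SemilocalMarkov
open LQ

set_option maxRecDepth 4000 in  -- `i < cuts.length` unfolds a 298-element list
/-- all 298 pieces of `certFiftyNineKinked2061` check (the two half-range compositions `check_FiftyNineKinked2061_piecesA/B`). -/
theorem check_FiftyNineKinked2061_pieces : ∀ i, i < certFiftyNineKinked2061.cuts.length → certFiftyNineKinked2061.checkPiecePW i = true := by
  intro i hi
  have hi' : i < 298 := hi
  by_cases h : i < 144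
  · exact check_FiftyNineKinked2061_piecesA i h
  · exact check_FiftyNineKinked2061_piecesB i (Nat.not_lt.mp h) hi'

/-! ### The theorems -/

open Summit.RiemannHypothesis.RiemannHypothesis.Theorems.HandoffMarginLaw (wallOffset)

/-- **`a*(2,…,59) ≤ 1055 / 512 = 2.060546875`** — the wall `q = 61` from the KINKED witness (the tree's polynomial row:
`267/128`, `SemilocalNegCertUptoFiftyNine`). RH-free. -/
theorem weilSemilocalThreshold_uptoFiftyNine_le_2061 :
    weilSemilocalThreshold {2, 3, 5, 7, 11, 13, 17, 19, 23, 29, 31, 37, 41, 43, 47, 53, 59} ≤ ((1055 / 512 : ℚ) : ℝ) :=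
  weilSemilocalThreshold_le_of_checkPW_sharp certFiftyNineKinked2061 atomsEnclose_UptoFiftyNineN63
    check_FiftyNineKinked2061_main check_FiftyNineKinked2061_atoms check_FiftyNineKinked2061_pieces

/-- Failure form: positivity of the `{∞,2,…,59}` form fails on every cone `C(B)`, `B > 1055 / 512`. -/
theorem not_weilSemilocalPositivityOn_uptoFiftyNine_of_gt_2061 {B : ℝ} (hB : (1055 / 512 : ℝ) < B) :
    ¬ WeilSemilocalPositivityOn {2, 3, 5, 7, 11, 13, 17, 19, 23, 29, 31, 37, 41, 43, 47, 53, 59} B := by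
  rw [not_weilSemilocalPositivityOn_iff_weilSemilocalThreshold_lt]
  have h := weilSemilocalThreshold_uptoFiftyNine_le_2061
  push_cast at h
  linarith

/-- **`a*(S) ≤ 1055 / 512` for every finite `S` of least missing prime `61`** (`{p < 61} ⊆ S ∌ 61`; the class of `61`, by first-gap locality
`SemilocalClassLaw.weilSemilocalThreshold_eq_of_classLawAt'` at the PROVED instance `semilocalClassLawAt_sixtyone`). -/
theorem weilSemilocalThreshold_le_2061_of_mem {S : Finset ℕ} (hS : ∀ p : ℕ, p.Prime → p < 61 → p ∈ S) (h61 : 61 ∉ S) :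
    weilSemilocalThreshold S ≤ ((1055 / 512 : ℚ) : ℝ) := by
  rw [SemilocalClassLaw.weilSemilocalThreshold_eq_of_classLawAt' (by norm_num) hS h61 SemilocalClassLaw.semilocalClassLawAt_sixtyone,
    HandoffUpperClauses.primesBelow_sixtyone]
  exact weilSemilocalThreshold_uptoFiftyNine_le_2061

/-- `a*(S_61) ≤ 1055 / 512` in the `Nat.primesBelow` currency of the handoff / class-law files. -/
theorem weilSemilocalThreshold_primesBelow_sixtyone_le_2061 :
    weilSemilocalThreshold (Nat.primesBelow 61) ≤ ((1055 / 512 : ℚ) : ℝ) := by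
  rw [HandoffUpperClauses.primesBelow_sixtyone]
  exact weilSemilocalThreshold_uptoFiftyNine_le_2061

/-- **Two-sided KERNEL bracket of the class of `61`**: `1 ≤ a*(S) ≤ 1055 / 512` for every finite `S` with `{p < 61} ⊆ S ∌ 61`
(lower end: the `a = 1` rung through locality, `HandoffLadderRungOne.one_le_wall_of_ge_eight`; DATA `a*(S_61) = 2.0554656`). RH-free. -/
theorem weilSemilocalThreshold_mem_Icc_one_2061 {S : Finset ℕ} (hS : ∀ p : ℕ, p.Prime → p < 61 → p ∈ S) (h61 : 61 ∉ S) :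
    weilSemilocalThreshold S ∈ Set.Icc (1 : ℝ) ((1055 / 512 : ℚ) : ℝ) := by
  rw [SemilocalClassLaw.weilSemilocalThreshold_eq_of_classLawAt' (by norm_num) hS h61 SemilocalClassLaw.semilocalClassLawAt_sixtyone]
  exact ⟨HandoffLadderRungOne.one_le_wall_of_ge_eight (N := 61) (by norm_num), weilSemilocalThreshold_primesBelow_sixtyone_le_2061⟩

/-- **The wall offset in the kernel**: `δ*(61) = a*(S_61) − (log 61)/2 ≤ 1055 / 512 − (log 61)/2` (the polynomial row gave `267/128 − (log 61)/2`).
RH-free; the SIGN of `δ*(61)` is not claimed here. -/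
theorem wallOffset_sixtyone_le_2061 : wallOffset 61 ≤ 1055 / 512 - Real.log 61 / 2 := by
  have h := weilSemilocalThreshold_uptoFiftyNine_le_2061
  push_cast at h
  rw [wallOffset, HandoffUpperClauses.primesBelow_sixtyone]
  push_cast
  linarith

/-- … numerically: **`δ*(61) < 0.00511`** (the tree's polynomial row: `0.0305`; DATA, two engines: `δ*(61) ≈ 2.9e-05`). RH-free. -/
theorem wallOffset_sixtyone_lt_00511 : wallOffset 61 < 0.00511 := by
  have h := wallOffset_sixtyone_le_2061
  have hl := log_sixtyone_gt
  linarith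

end Summit.RiemannHypothesis.RiemannHypothesis.Theorems.SemilocalPolyWitness

end
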